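import Summits.RiemannHypothesis.RiemannHypothesis.Theorems.ThetaTier2RowsTwin01
import Summits.RiemannHypothesis.RiemannHypothesis.Theorems.ThetaTier2RowsTwin02
import Summits.RiemannHypothesis.RiemannHypothesis.Theorems.ThetaTier2RowsTwin03
import Summits.RiemannHypothesis.RiemannHypothesis.Theorems.ThetaTier2RowsTwin04
import Summits.RiemannHypothesis.RiemannHypothesis.Theorems.ThetaTier2RowsTwin05
import Summits.RiemannHypothesis.RiemannHypothesis.Theorems.ThetaTier2RowsTwin06
import Summits.RiemannHypothesis.RiemannHypothesis.Theorems.ThetaTier2RowsTwin07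
import Summits.RiemannHypothesis.RiemannHypothesis.Theorems.ThetaTier2RowsTwin08
import Summits.RiemannHypothesis.RiemannHypothesis.Theorems.ThetaTier2RowsTwin09
import Summits.RiemannHypothesis.RiemannHypothesis.Theorems.ThetaTier2RowsTwin10
import Summits.RiemannHypothesis.RiemannHypothesis.Theorems.ThetaTier2RowsTwin11
import Summits.RiemannHypothesis.RiemannHypothesis.Theorems.ThetaTier2RowsTwin12
import Summits.RiemannHypothesis.RiemannHypothesis.Theorems.ThetaTier2RowsTwin13
import Summits.RiemannHypothesis.RiemannHypothesis.Theorems.ThetaTier2CoverTwin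
import HarnessLib

/-!
# THETA tier-2 — ALL twin rows `157 ≤ q < 10⁴` in one list, with coverage (FIN glue for item 19172; cc-s2-1; RH-FREE)

Glue over the thirteen data modules `ThetaTier2RowsTwin01…13` and `ThetaTier2CoverTwin`: `allTwinRows` (the 193 rows in order),
`allTwinRows_valid` (every row carries `T2Valid r.inp r.real ∧ r.RowFacts`), the cover identity `allTwinRows.map Row2.q = twinQs` and the row
shape `r.qn = r.q + 2 ∧ r.m = 5` (kernel `decide`), hence **`exists_twin_row`**: every twin prime `q ∈ [157, 10⁴)` has a certified tier-2 row
with `qn = q + 2`.  The closer of `WallsTenKTwin` composes this with the E-side's `ucT2_of_valid`.  Nothing here bears on the truth of RH.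
-/

set_option linter.dupNamespace false  -- the mandated namespace repeats `RiemannHypothesis`
set_option autoImplicit false

namespace Summit.RiemannHypothesis.RiemannHypothesis.Theorems.ThetaTier2

/-- All 193 tier-2 twin rows, in order. [this cell] -/
def allTwinRows : List Row2 :=
  twinRows01_1 ++ twinRows01_2 ++ twinRows02_1 ++ twinRows02_2 ++ twinRows03_1 ++ twinRows03_2 ++ twinRows04_1 ++
  twinRows04_2 ++ twinRows05_1 ++ twinRows05_2 ++ twinRows06_1 ++ twinRows06_2 ++ twinRows07_1 ++ twinRows07_2 ++
  twinRows08_1 ++ twinRows08_2 ++ twinRows09_1 ++ twinRows09_2 ++ twinRows10_1 ++ twinRows10_2 ++ twinRows11_1 ++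
  twinRows11_2 ++ twinRows12_1 ++ twinRows12_2 ++ twinRows13_1

/-- **Every row is certified**: (K1)–(K7) for its real data and the row facts. [this cell, THETA-CERT-cc6 §E6] -/
theorem allTwinRows_valid : ∀ r ∈ allTwinRows, T2Valid r.inp r.real ∧ r.RowFacts :=
  List.forall_mem_append.2 ⟨List.forall_mem_append.2 ⟨List.forall_mem_append.2 ⟨List.forall_mem_append.2 ⟨List.forall_mem_append.2 ⟨List.forall_mem_append.2 ⟨
  List.forall_mem_append.2 ⟨List.forall_mem_append.2 ⟨List.forall_mem_append.2 ⟨List.forall_mem_append.2 ⟨List.forall_mem_append.2 ⟨List.forall_mem_append.2 ⟨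
  List.forall_mem_append.2 ⟨List.forall_mem_append.2 ⟨List.forall_mem_append.2 ⟨List.forall_mem_append.2 ⟨List.forall_mem_append.2 ⟨List.forall_mem_append.2 ⟨
  List.forall_mem_append.2 ⟨List.forall_mem_append.2 ⟨List.forall_mem_append.2 ⟨List.forall_mem_append.2 ⟨List.forall_mem_append.2 ⟨List.forall_mem_append.2 ⟨
    twinRows01_1_valid,
    twinRows01_2_valid⟩,
    twinRows02_1_valid⟩,
    twinRows02_2_valid⟩,
    twinRows03_1_valid⟩,
    twinRows03_2_valid⟩,
    twinRows04_1_valid⟩,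
    twinRows04_2_valid⟩,
    twinRows05_1_valid⟩,
    twinRows05_2_valid⟩,
    twinRows06_1_valid⟩,
    twinRows06_2_valid⟩,
    twinRows07_1_valid⟩,
    twinRows07_2_valid⟩,
    twinRows08_1_valid⟩,
    twinRows08_2_valid⟩,
    twinRows09_1_valid⟩,
    twinRows09_2_valid⟩,
    twinRows10_1_valid⟩,
    twinRows10_2_valid⟩,
    twinRows11_1_valid⟩,
    twinRows11_2_valid⟩,
    twinRows12_1_valid⟩,
    twinRows12_2_valid⟩,
    twinRows13_1_valid⟩

/-- The rows' abscissae are `twinQs` of `ThetaTier2CoverTwin`. [this cell] -/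
theorem allTwinRows_q : allTwinRows.map Row2.q = twinQs := by decide +kernel

/-- Every row is a twin row of order `5`: `qn = q + 2`, `m = 5`. [this cell] -/
theorem allTwinRows_shape : allTwinRows.all (fun r => decide (r.qn = r.q + 2) && decide (r.m = 5)) = true := by decide +kernel

/-- **Every twin prime `q ∈ [157, 10⁴)` has a certified tier-2 row** with `qn = q + 2`, `m = 5`. [this cell] -/
theorem exists_twin_row (q : ℕ) (h1 : 157 ≤ q) (h2 : q < 10000) (hp : q.Prime) (hn : (q + 2).Prime) :
    ∃ r ∈ allTwinRows, r.q = q ∧ r.qn = q + 2 ∧ r.m = 5 ∧ T2Valid r.inp r.real ∧ r.RowFacts := by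
  have hq : q ∈ allTwinRows.map Row2.q := by rw [allTwinRows_q]; exact twin_cover q h1 h2 hp hn
  obtain ⟨r, hr, hrq⟩ := List.mem_map.1 hq
  have hs := List.all_eq_true.1 allTwinRows_shape r hr
  simp only [Bool.and_eq_true, decide_eq_true_eq] at hs
  exact ⟨r, hr, hrq, hrq ▸ hs.1, hs.2, allTwinRows_valid r hr⟩

/-- From a module's `rows.all Row2.check = true` to the pointwise form. [this cell] -/
theorem allRows_check_of_all {rows : List Row2} (h : rows.all Row2.check = true) : ∀ r ∈ rows, r.check = true :=
  List.all_eq_true.1 h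

/-- **Every row passes `Row2.check`** (pointwise over `allTwinRows`; the data modules' `_check` theorems). [this cell] -/
theorem allTwinRows_check : ∀ r ∈ allTwinRows, r.check = true :=
  List.forall_mem_append.2 ⟨List.forall_mem_append.2 ⟨List.forall_mem_append.2 ⟨List.forall_mem_append.2 ⟨List.forall_mem_append.2 ⟨List.forall_mem_append.2 ⟨
  List.forall_mem_append.2 ⟨List.forall_mem_append.2 ⟨List.forall_mem_append.2 ⟨List.forall_mem_append.2 ⟨List.forall_mem_append.2 ⟨List.forall_mem_append.2 ⟨
  List.forall_mem_append.2 ⟨List.forall_mem_append.2 ⟨List.forall_mem_append.2 ⟨List.forall_mem_append.2 ⟨List.forall_mem_append.2 ⟨List.forall_mem_append.2 ⟨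
  List.forall_mem_append.2 ⟨List.forall_mem_append.2 ⟨List.forall_mem_append.2 ⟨List.forall_mem_append.2 ⟨List.forall_mem_append.2 ⟨List.forall_mem_append.2 ⟨
    allRows_check_of_all twinRows01_1_check,
    allRows_check_of_all twinRows01_2_check⟩,
    allRows_check_of_all twinRows02_1_check⟩,
    allRows_check_of_all twinRows02_2_check⟩,
    allRows_check_of_all twinRows03_1_check⟩,
    allRows_check_of_all twinRows03_2_check⟩,
    allRows_check_of_all twinRows04_1_check⟩,
    allRows_check_of_all twinRows04_2_check⟩,
    allRows_check_of_all twinRows05_1_check⟩,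
    allRows_check_of_all twinRows05_2_check⟩,
    allRows_check_of_all twinRows06_1_check⟩,
    allRows_check_of_all twinRows06_2_check⟩,
    allRows_check_of_all twinRows07_1_check⟩,
    allRows_check_of_all twinRows07_2_check⟩,
    allRows_check_of_all twinRows08_1_check⟩,
    allRows_check_of_all twinRows08_2_check⟩,
    allRows_check_of_all twinRows09_1_check⟩,
    allRows_check_of_all twinRows09_2_check⟩,
    allRows_check_of_all twinRows10_1_check⟩,
    allRows_check_of_all twinRows10_2_check⟩,
    allRows_check_of_all twinRows11_1_check⟩,
    allRows_check_of_all twinRows11_2_check⟩,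
    allRows_check_of_all twinRows12_1_check⟩,
    allRows_check_of_all twinRows12_2_check⟩,
    allRows_check_of_all twinRows13_1_check⟩

/-- **Every twin prime `q ∈ [157, 10⁴)` has a row passing `Row2.check`** with `qn = q + 2`, `m = 5` (the form a bridge taking `check = true`
consumes; `T2Valid`/`RowFacts` then by `Row2.check_sound`). [this cell] -/
theorem exists_twin_row_check (q : ℕ) (h1 : 157 ≤ q) (h2 : q < 10000) (hp : q.Prime) (hn : (q + 2).Prime) :
    ∃ r ∈ allTwinRows, r.q = q ∧ r.qn = q + 2 ∧ r.m = 5 ∧ r.check = true := by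
  obtain ⟨r, hr, hrq, hrqn, hrm, -, -⟩ := exists_twin_row q h1 h2 hp hn
  exact ⟨r, hr, hrq, hrqn, hrm, allTwinRows_check r hr⟩


end Summit.RiemannHypothesis.RiemannHypothesis.Theorems.ThetaTier2
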